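import Literature.NumberTheory.Sieve.ChenShiftedSiftedDvdUpperCore
import Literature.NumberTheory.Sieve.ChenShiftedAssembly
import HarnessLib

/-!
# Chen's Theorem II: hypothesis (B) of the assembly, `∑_q S(𝒜_h(x)_q, ⌈x^{1/10}⌉) ≤ (b + ε) x V_h/log x`

Companion of `ChenShiftedAssembly.lean` and `ChenShiftedSiftedDvdUpperCore.lean`. The core file proves
Chen's (32) for the sifted subsequence `𝒜'_h(x) = {p + h : h < p ≤ x}` over the real window
`x^{1/10} ≤ q < x^{1/3}` (`midPrimes`); hypothesis (B) of
`Literature.NumberTheory.Sieve.Chen.Chen1973_theoremII_of` is stated for the full `𝒜_h(x) = {p + h : p ≤ x}`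
(`shiftSieveSet`) over the integer window `⌈x^{1/10}⌉ ≤ q < chenY h x = ⌈(x + h + 1)^{1/3}⌉` of the
weighted sieve. This file PROVES (B) from the core estimate:

* `roughMultCount_shift_tenth_sum_upper` — for even `h ≠ 0`, every `ε > 0` and all large `x`,
  `∑_{q ∈ primesIco (chenZ x) (chenY h x)} S(𝒜_h(x)_q, ⌈x^{1/10}⌉) ≤ (b + ε) x V_h(x^{1/10})/log x`,
  `b = ∫_{1/10}^{1/3} F₁(5 − 10β) dβ/β`.

The two small discrepancies are harmless: for `2h < x^{1/10}` the rough multiples of `q` in `𝒜_h(x)` lie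
in `𝒜'_h(x)` (`roughMultCount_shiftSieveSet_le`), and `chenY h x ≤ ⌈x^{1/3}⌉ + 1` once `h ≤ 3x^{2/3}`, so the
integer window exceeds the real one by at most the single modulus `q = ⌈x^{1/3}⌉`, whose term is at most
`⌊(x + h)/q⌋ ≤ 4x^{2/3} = o(x V_h/log x)` (`roughMultCount_le_div`, `eventually_shiftUnit_ge`). No named facts.

## References

* Chen Jing-run, Sci. Sinica 16 (1973) 157–176, Lemma 9, (32) and §III (reprint: Wang Yuan (ed.),
  *Goldbach Conjecture*, 1984, PDF pp. 167–168). [ChenSciSinica1973]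
-/

open Finset Filter Topology

noncomputable section

namespace Literature.NumberTheory.Sieve.Chen

open SieveSequence ChenSieve

/-- **Chen's (32) for the shifted sequence — hypothesis (B) of `Chen1973_theoremII_of`, PROVED**: for
even `h ≠ 0`, every `ε > 0` and all large `x`,
`∑_{⌈x^{1/10}⌉ ≤ q < chenY h x} S(𝒜_h(x)_q, ⌈x^{1/10}⌉) ≤ (b + ε) · x V_h(x^{1/10})/log x`,
`b = ∫_{1/10}^{1/3} F₁(5 − 10β) dβ/β` (from the core estimate `roughMultCount_shift'_tenth_sum_upper` over
`x^{1/10} ≤ q < x^{1/3}` for `𝒜'_h(x)`; the extra modulus `q = ⌈x^{1/3}⌉` contributes `≤ 4x^{2/3}`).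
[cite: ChenSciSinica1973, Lemma 9 eq. (32) and §III (reprint pp. 167–168)] -/
theorem roughMultCount_shift_tenth_sum_upper {h : ℕ} (hh : Even h) (hh0 : h ≠ 0) {ε : ℝ} (hε : 0 < ε) :
    ∀ᶠ x : ℕ in atTop,
      (∑ q ∈ primesIco (chenZ x) (chenY h x), (roughMultCount (shiftSieveSet h x) (chenZ x) q : ℝ)) ≤
        ((∫ β in (1 / 10 : ℝ)..(1 / 3), upperSieveFun 1 (5 - 10 * β) / β) + ε) *
          ((x : ℝ) * sieveProduct h ((x : ℝ) ^ (1 / 10 : ℝ)) / Real.log x) := by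
  set b := ∫ β in (1 / 10 : ℝ)..(1 / 3), upperSieveFun 1 (5 - 10 * β) / β with hb
  have hb0 : 0 ≤ b := integral_upperSieveFun_tenth_nonneg
  have hε2 : 0 < ε / 2 := by positivity
  have hC2 : 0 < twinPrimeConst := twinPrimeConst_pos_holds
  have hcore := roughMultCount_shift'_tenth_sum_upper hh hh0 hε2
  have hunit := eventually_shiftUnit_ge hh hh0 (show (0 : ℝ) < 1 / 2 by norm_num)
  have hjunk := eventually_rpow_le_mul_div_log_sq (θ := 2 / 3) (K := 4)
    (c := ε / 2 * (10 / 3 * twinPrimeConst)) (by norm_num) (by positivity)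
  have hz : ∀ᶠ x : ℕ in atTop, (2 * h : ℝ) < (x : ℝ) ^ (1 / 10 : ℝ) :=
    ((tendsto_rpow_atTop (by norm_num : (0 : ℝ) < 1 / 10)).comp
      tendsto_natCast_atTop_atTop).eventually_gt_atTop _
  have hy : ∀ᶠ x : ℕ in atTop, (h : ℝ) / 3 ≤ (x : ℝ) ^ (2 / 3 : ℝ) :=
    ((tendsto_rpow_atTop (by norm_num : (0 : ℝ) < 2 / 3)).comp
      tendsto_natCast_atTop_atTop).eventually_ge_atTop _
  filter_upwards [hcore, hunit, hjunk, hz, hy, eventually_ge_atTop 2] with x hcx hux hjx hzx hyx hx2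
  have hx1 : (1 : ℝ) < x := by exact_mod_cast (show 1 < x by omega)
  have hx0 : (0 : ℝ) < x := by linarith
  have hlog : 0 < Real.log x := Real.log_pos hx1
  set zN := (x : ℝ) ^ (1 / 10 : ℝ) with hzN
  set yN := (x : ℝ) ^ (1 / 3 : ℝ) with hyN
  have hzx' : (2 * h : ℝ) < zN := hzx
  have hyx' : (h : ℝ) / 3 ≤ (x : ℝ) ^ (2 / 3 : ℝ) := hyx
  have hyN0 : 0 ≤ yN := Real.rpow_nonneg hx0.le _
  have hyN1 : 1 ≤ yN := Real.one_le_rpow hx1.le (by norm_num)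
  have hy3 : yN ^ 3 = x := by
    rw [hyN, ← Real.rpow_natCast, ← Real.rpow_mul hx0.le]; norm_num
  have hy2 : yN ^ 2 = (x : ℝ) ^ (2 / 3 : ℝ) := by
    rw [hyN, ← Real.rpow_natCast, ← Real.rpow_mul hx0.le]; norm_num
  -- the unit `W` and its lower bound `(10/3) C₂ x/(log x)² ≤ W`
  set W : ℝ := (x : ℝ) * sieveProduct h zN / Real.log x with hW
  have heγ : 1 / 3 ≤ Real.exp (-Real.eulerMascheroniConstant) := by
    have h1 := Real.add_one_le_exp (-Real.eulerMascheroniConstant)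
    have h2 := Real.eulerMascheroniConstant_lt_two_thirds
    linarith
  have hS := singularSeries_pos h
  have hC2S : twinPrimeConst ≤ singularSeries h := twinPrimeConst_le_singularSeries h
  have hWlow : 10 / 3 * twinPrimeConst * x / Real.log x ^ 2 ≤ W := by
    have hux' : (1 - 1 / 2) * (20 * Real.exp (-Real.eulerMascheroniConstant) *
        (singularSeries h * x / Real.log x ^ 2)) ≤ W := hux
    have hQ : 0 ≤ (x : ℝ) / Real.log x ^ 2 := by positivity
    have h1 : 10 / 3 * twinPrimeConst ≤ 10 * Real.exp (-Real.eulerMascheroniConstant) * singularSeries h := by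
      have := mul_le_mul heγ hC2S hC2.le (by positivity)
      nlinarith
    have h2 := mul_le_mul_of_nonneg_right h1 hQ
    have e1 : 10 / 3 * twinPrimeConst * x / Real.log x ^ 2 =
        10 / 3 * twinPrimeConst * ((x : ℝ) / Real.log x ^ 2) := by ring
    have e2 : (1 - 1 / 2) * (20 * Real.exp (-Real.eulerMascheroniConstant) *
        (singularSeries h * x / Real.log x ^ 2)) =
        10 * Real.exp (-Real.eulerMascheroniConstant) * singularSeries h * ((x : ℝ) / Real.log x ^ 2) := by
      ring
    rw [e1]
    rw [e2] at hux'
    exact h2.trans hux'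
  have hW0 : 0 ≤ W := le_trans (by positivity) hWlow
  -- (a) `chenY h x ≤ ⌈yN⌉ + 1`
  have hY : chenY h x ≤ ⌈yN⌉₊ + 1 := by
    have h3 : ((x : ℝ) + h + 1) ≤ (yN + 1) ^ 3 := by
      have e : (yN + 1) ^ 3 = yN ^ 3 + 3 * yN ^ 2 + 3 * yN + 1 := by ring
      rw [e, hy3, hy2]
      nlinarith
    have h4 : ((x : ℝ) + h + 1) ^ (1 / 3 : ℝ) ≤ yN + 1 := by
      calc ((x : ℝ) + h + 1) ^ (1 / 3 : ℝ) ≤ ((yN + 1) ^ 3) ^ (1 / 3 : ℝ) :=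
            Real.rpow_le_rpow (by positivity) h3 (by norm_num)
        _ = yN + 1 := by
            rw [← Real.rpow_natCast, ← Real.rpow_mul (by positivity)]; norm_num
    calc chenY h x = ⌈((x : ℝ) + h + 1) ^ (1 / 3 : ℝ)⌉₊ := rfl
      _ ≤ ⌈yN + 1⌉₊ := Nat.ceil_mono h4
      _ = ⌈yN⌉₊ + 1 := Nat.ceil_add_one hyN0
  -- (b) `2h < chenZ x`
  have hZ : 2 * h < chenZ x := by
    have : (2 * h : ℝ) < ((chenZ x : ℕ) : ℝ) := hzx'.trans_le (rpow_le_chenZ x)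
    exact_mod_cast this
  -- (c) split the integer window at `⌈yN⌉`
  classical
  set P := primesIco (chenZ x) (chenY h x) with hP
  set f : ℕ → ℝ := fun q => (roughMultCount (shiftSieveSet h x) (chenZ x) q : ℝ) with hf
  have hf0 : ∀ q, 0 ≤ f q := fun q => Nat.cast_nonneg _
  have hsplit : ∑ q ∈ P, f q =
      ∑ q ∈ P.filter (fun q : ℕ => q < ⌈yN⌉₊), f q + ∑ q ∈ P.filter (fun q : ℕ => ¬ q < ⌈yN⌉₊), f q :=
    (Finset.sum_filter_add_sum_filter_not P _ f).symm
  -- part 1: inside the real window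
  have hsub1 : P.filter (fun q : ℕ => q < ⌈yN⌉₊) ⊆ midPrimes zN yN := by
    intro q hq
    rw [Finset.mem_filter, hP, mem_primesIco] at hq
    obtain ⟨⟨hqp, hzq, -⟩, hqm⟩ := hq
    rw [midPrimes, Finset.mem_filter, Nat.mem_primesBelow]
    exact ⟨⟨hqm, hqp⟩, chenZ_le_iff.mp hzq⟩
  have hpart1 : ∑ q ∈ P.filter (fun q : ℕ => q < ⌈yN⌉₊), f q ≤ (b + ε / 2) * W := by
    calc ∑ q ∈ P.filter (fun q : ℕ => q < ⌈yN⌉₊), f q ≤ ∑ q ∈ midPrimes zN yN, f q :=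
          Finset.sum_le_sum_of_subset_of_nonneg hsub1 fun q _ _ => hf0 q
      _ ≤ ∑ q ∈ midPrimes zN yN, (roughMultCount (shiftSieveSet' h x) (chenZ x) q : ℝ) :=
          Finset.sum_le_sum fun q _ => by
            simp only [hf]
            exact_mod_cast roughMultCount_shiftSieveSet_le hZ q
      _ ≤ (b + ε / 2) * W := hcx
  -- part 2: at most the single modulus `⌈yN⌉`
  have hsub2 : P.filter (fun q : ℕ => ¬ q < ⌈yN⌉₊) ⊆ {⌈yN⌉₊} := by
    intro q hq
    rw [Finset.mem_filter, hP, mem_primesIco] at hq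
    obtain ⟨⟨-, -, hqY⟩, hqm⟩ := hq
    rw [Finset.mem_singleton]
    have := hY
    omega
  have hfm : f ⌈yN⌉₊ ≤ 4 * (x : ℝ) ^ (2 / 3 : ℝ) := by
    have h1 : f ⌈yN⌉₊ ≤ (((x + h) / ⌈yN⌉₊ : ℕ) : ℝ) := by
      simp only [hf]
      exact_mod_cast roughMultCount_le_div h x (chenZ x) ⌈yN⌉₊
    have h2 : (((x + h) / ⌈yN⌉₊ : ℕ) : ℝ) ≤ ((x + h : ℕ) : ℝ) / ((⌈yN⌉₊ : ℕ) : ℝ) := Nat.cast_div_le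
    have hm0 : (0 : ℝ) < ((⌈yN⌉₊ : ℕ) : ℝ) := by
      have : 0 < ⌈yN⌉₊ := Nat.ceil_pos.mpr (by linarith)
      exact_mod_cast this
    have h3 : ((x + h : ℕ) : ℝ) / ((⌈yN⌉₊ : ℕ) : ℝ) ≤ ((x : ℝ) + h) / yN := by
      rw [Nat.cast_add]
      exact div_le_div_of_nonneg_left (by positivity) (by linarith) (Nat.le_ceil _)
    have h4 : ((x : ℝ) + h) / yN ≤ 4 * yN ^ 2 := by
      rw [div_le_iff₀ (by linarith)]
      have : (h : ℝ) ≤ 3 * yN ^ 2 := by rw [hy2]; linarith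
      nlinarith [hy3, hyN1]
    calc f ⌈yN⌉₊ ≤ ((x : ℝ) + h) / yN := h1.trans (h2.trans h3)
      _ ≤ 4 * yN ^ 2 := h4
      _ = 4 * (x : ℝ) ^ (2 / 3 : ℝ) := by rw [hy2]
  have hpart2 : ∑ q ∈ P.filter (fun q : ℕ => ¬ q < ⌈yN⌉₊), f q ≤ ε / 2 * W := by
    calc ∑ q ∈ P.filter (fun q : ℕ => ¬ q < ⌈yN⌉₊), f q ≤ ∑ q ∈ ({⌈yN⌉₊} : Finset ℕ), f q :=
          Finset.sum_le_sum_of_subset_of_nonneg hsub2 fun q _ _ => hf0 q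
      _ = f ⌈yN⌉₊ := Finset.sum_singleton _ _
      _ ≤ 4 * (x : ℝ) ^ (2 / 3 : ℝ) := hfm
      _ ≤ ε / 2 * (10 / 3 * twinPrimeConst) * x / Real.log x ^ 2 := hjx
      _ = ε / 2 * (10 / 3 * twinPrimeConst * x / Real.log x ^ 2) := by ring
      _ ≤ ε / 2 * W := mul_le_mul_of_nonneg_left hWlow hε2.le
  -- conclusion
  show ∑ q ∈ P, f q ≤ (b + ε) * W
  rw [hsplit]
  have e : (b + ε) * W = (b + ε / 2) * W + ε / 2 * W := by ring
  rw [e]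
  exact add_le_add hpart1 hpart2

end Literature.NumberTheory.Sieve.Chen
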